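import Literature.NumberTheory.Sieve.IwaniecAlmostPrimesQuadraticProp2Lower
import Literature.NumberTheory.Sieve.IwaniecAlmostPrimesProp1Corollary
import HarnessLib

/-!
# Iwaniec (1978) for a general quadratic `G`: the Corollary of Proposition 1 from Proposition 1 — PROVED

H. Iwaniec, *Almost-primes represented by quadratic polynomials*, Invent. Math. **47** (1978)
171–188, p. 176 [cite: IwaniecInventiones1978, Corollary p. 176], for the sequence
`𝒜 = 𝒜_G = {|G(n)| : n ≤ x}`, `G = aX² + bX + c` (`a > 0`, `G` irreducible), in the notation of
`IwaniecAlmostPrimesQuadraticProp2Prep.lean` (`r(𝒜; d) = remG`, `B(x; m, N) = bilinearBG`,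
`ρ_G = rhoG`); R. J. Lemke Oliver, Acta Arith. **151** (2012) 241–261, Lemma 3 and (2.7)
[cite: LemkeOliverActaArith2012, Lemma 3] (the same deduction for a general quadratic).

Tenth file of the inline proof of `theorem_quadratic` (`IwaniecAlmostPrimes.lean`).  After
`IwaniecAlmostPrimesQuadraticProp2Lower.lean` the general Theorem rests on the single hypothesis
`proposition1G_corollary a b c` (the level of distribution `x^{16/15}` of `𝒜_G` in bilinear form,
Iwaniec's Corollary of Proposition 1 for `𝒜_G`).  This file moves that hypothesis one step down,
exactly as `IwaniecAlmostPrimesProp1Corollary.lean` does for `n² + 1`: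

* `proposition1G a b c` — **Proposition 1 for `𝒜_G`** as a predicate (the dispersion estimate
  `∑_{M<m<2M} B(x; m, N)² ≪_ε (1 + N^{7/2} M^{−5/4} x) x^{1+ε}`, p. 176; a HYPOTHESIS with
  parameters, never a closed named fact — for `G = X² + 1` it is the tree's PROVED `proposition1`,
  `proposition1G_one_zero_one_iff`, `proposition1G_one_zero_one`);
* `card_filter_Ico_dvd_gAbs`, `abs_remG_le_rhoG` (`|r(𝒜; d)| ≤ ρ_G(d)`: on `d` consecutive
  integers `G(n) ≡ 0 (mod d)` has exactly `ρ_G(d)` solutions), `abs_bilinearBG_le`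
  (`|B(x; m, N)| ≤ ρ_G(m) ∑_{n<N} ρ_G(n)`), `sq_sum_abs_bilinearBG_le` (Cauchy on a dyadic block),
  `exists_sum_rhoG_le` (`∑_{m ≤ y} ρ_G(m) ≤ C_G y`, the tree's
  `Literature.NumberTheory.Sieve.exists_sum_rootCount_le`);
* **`proposition1G_corollary_of_prop1G : proposition1G a b c → proposition1G_corollary a b c`**
  (p. 176: trivial estimate for `m < x^{14/15−ε}`, Cauchy + Proposition 1 on `≤ 2 log x` dyadic
  classes for `x^{14/15−ε} ≤ m < x^{1−4ε}`; the block arithmetic `block_size_le` is the tree's);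
* the assembled reductions `theorem_quadratic_of_proposition1G`
  (`(∀ G, proposition1G G) → theorem_quadratic`) and
  `infinite_setOf_isAtMostAlmostPrime_of_proposition1G` (the qualitative clause for one `G`).

So after this file: `theorem_quadratic ⇐ ∀ G, proposition1G G` (the dispersion bound for `𝒜_G`,
Iwaniec §4 pp. 181–185 ⇐ Lemma 4 for `G`, i.e. the equidistribution of the roots of
`G(Ω) ≡ 0 (mod qm)` — Lemke Oliver §3).  Everything here is PROVED; no named fact is introduced.

## References

* H. Iwaniec, Invent. Math. 47 (1978) 171–188, Proposition 1 and its Corollary, p. 176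
  (`IwaniecInventiones1978`).
* R. J. Lemke Oliver, Acta Arith. 151 (2012) 241–261, Lemma 3, (2.7), (2.17)
  (`LemkeOliverActaArith2012`).
-/

open Finset Real Polynomial Filter

noncomputable section

namespace Literature.NumberTheory.Sieve.Iwaniec1978

variable {a b c : ℤ}

/-! ### Proposition 1 for `𝒜_G` as a predicate -/

/-- **Iwaniec 1978, Proposition 1 (p. 176), for `𝒜 = 𝒜_G`** (`G = aX² + bX + c`): for real `b_n`
with `|b_n| ≤ 1` supported on squarefree `n`, `1 ≤ M < x`, `N ≥ 1` and `ε > 0`,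
`∑_{M < m < 2M} B(x; m, N)² ≤ C(ε, G) (1 + N^{7/2} M^{−5/4} x) x^{1+ε}`.
A predicate with parameters (the hypothesis of `proposition1G_corollary_of_prop1G`), not a named
fact; Iwaniec proves it for `X² + 1` (the tree's `proposition1_holds`) and states that the general
case is similar (p. 172); Lemke Oliver (2.17) is the general-`G` dispersion bound with unspecified
exponents. [cite: IwaniecInventiones1978, Proposition 1] -/
def proposition1G (a b c : ℤ) : Prop :=
  ∀ ε : ℝ, 0 < ε → ∃ C : ℝ, ∀ (x M N : ℝ) (bc : ℕ → ℝ), 1 ≤ M → M < x → 1 ≤ N →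
    (∀ n, |bc n| ≤ 1) → (∀ n, ¬ Squarefree n → bc n = 0) →
      ∑ m ∈ (Finset.Icc 1 ⌈2 * M⌉₊).filter (fun m : ℕ => M < m ∧ (m : ℝ) < 2 * M),
          bilinearBG a b c x bc m N ^ 2 ≤
        C * (1 + N ^ (7 / 2 : ℝ) * M ^ (-(5 / 4 : ℝ)) * x) * x ^ (1 + ε)

/-- `proposition1G 1 0 1 ↔ proposition1` (`B_G = B` for `G = X² + 1`, `bilinearBG_one_zero_one`).
[folklore] -/
theorem proposition1G_one_zero_one_iff : proposition1G 1 0 1 ↔ proposition1 := by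
  unfold proposition1G proposition1
  simp only [bilinearBG_one_zero_one]

/-- Proposition 1 for `𝒜_{X²+1}` through the general-`G` predicate (the tree's `proposition1_holds`).
[cite: IwaniecInventiones1978, Proposition 1] -/
theorem proposition1G_one_zero_one : proposition1G 1 0 1 :=
  proposition1G_one_zero_one_iff.mpr proposition1_holds

/-! ### The trivial bound `|r(𝒜; d)| ≤ ρ_G(d)` -/

/-- `d ∣ |G(n)|` iff `d ∣ G(n)` in `ℤ`. [folklore] -/
theorem dvd_gAbs_iff {d n : ℕ} : d ∣ gAbs a b c n ↔ (d : ℤ) ∣ a * (n : ℤ) ^ 2 + b * n + c := by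
  unfold gAbs
  exact Int.natCast_dvd.symm

/-- `ρ_G(d)` counts the `n < d` with `d ∣ |G(n)|`. [folklore] -/
theorem rhoG_eq_card_filter_range (d : ℕ) :
    rhoG a b c d = ((Finset.range d).filter fun n : ℕ => d ∣ gAbs a b c n).card := by
  unfold rhoG polyRootCountMod
  congr 1
  ext n
  simp only [Finset.mem_filter, Fin.prod_univ_one, Matrix.cons_val_fin_one, eval_quadPoly,
    dvd_gAbs_iff]

/-- The divisibility `d ∣ |G(n)|` is `d`-periodic in `n`: `G(n + d) = G(n) + d(2an + ad + b)`.
[folklore] -/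
theorem periodic_dvd_gAbs (d : ℕ) : Function.Periodic (fun n : ℕ => d ∣ gAbs a b c n) d := by
  intro n
  simp only [dvd_gAbs_iff, eq_iff_iff]
  have e : a * ((n + d : ℕ) : ℤ) ^ 2 + b * ((n + d : ℕ) : ℤ) + c =
      (d : ℤ) * (2 * a * n + a * d + b) + (a * (n : ℤ) ^ 2 + b * n + c) := by
    push_cast; ring
  rw [e]
  exact dvd_add_right (dvd_mul_right _ _)

/-- On any `d` consecutive integers the congruence `G(n) ≡ 0 (mod d)` has exactly `ρ_G(d)`
solutions. [folklore] -/
theorem card_filter_Ico_dvd_gAbs (d k : ℕ) :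
    ((Finset.Ico k (k + d)).filter fun n : ℕ => d ∣ gAbs a b c n).card = rhoG a b c d := by
  rw [Nat.filter_Ico_card_eq_of_periodic k d _ (periodic_dvd_gAbs d),
    Nat.count_eq_card_filter_range, rhoG_eq_card_filter_range]

/-- `q` full periods starting at `1` contain exactly `q ρ_G(d)` solutions. [folklore] -/
theorem card_filter_Ico_one_dvd_gAbs (d q : ℕ) :
    ((Finset.Ico 1 (1 + q * d)).filter fun n : ℕ => d ∣ gAbs a b c n).card = q * rhoG a b c d := by
  induction q with
  | zero => simp
  | succ q ih =>
    have hsplit : Finset.Ico 1 (1 + (q + 1) * d) =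
        Finset.Ico 1 (1 + q * d) ∪ Finset.Ico (1 + q * d) (1 + q * d + d) := by
      rw [Finset.Ico_union_Ico_eq_Ico (by omega) (by omega)]
      congr 1; ring
    rw [hsplit, Finset.filter_union,
      Finset.card_union_of_disjoint
        (Finset.disjoint_filter_filter (Finset.Ico_disjoint_Ico_consecutive _ _ _)),
      ih, card_filter_Ico_dvd_gAbs]
    ring

/-- `|𝒜_d|` with the decidability instance of `ℕ`-divisibility. [folklore] -/
theorem congrCountG_eq (x : ℝ) (d : ℕ) :
    congrCountG a b c x d = ((Finset.Icc 1 ⌊x⌋₊).filter fun n : ℕ => d ∣ gAbs a b c n).card := by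
  unfold congrCountG
  convert rfl

/-- **The trivial estimate `|r(𝒜; d)| ≤ ρ_G(d)`** (`d ≥ 1`, `x ≥ 0`): `[1, x]` consists of `⌊x⌋/d`
full periods, each with exactly `ρ_G(d)` solutions of `G(n) ≡ 0 (mod d)`, and a partial one
(p. 176: "trivial estimate"; Lemke Oliver p. 250). [cite: IwaniecInventiones1978, §4 p. 176] -/
theorem abs_remG_le_rhoG {x : ℝ} (hx : 0 ≤ x) {d : ℕ} (hd : d ≠ 0) :
    |remG a b c x d| ≤ rhoG a b c d := by
  unfold remG
  rw [congrCountG_eq]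
  set X := ⌊x⌋₊ with hXdef
  set q := X / d with hq
  have hdpos : 0 < d := Nat.pos_of_ne_zero hd
  have hqd : d * q + X % d = X := Nat.div_add_mod X d
  have hmod : X % d < d := Nat.mod_lt X hdpos
  have hlow : q * rhoG a b c d ≤
      ((Finset.Icc 1 X).filter fun n : ℕ => d ∣ gAbs a b c n).card := by
    rw [← card_filter_Ico_one_dvd_gAbs d q]
    refine Finset.card_le_card (Finset.filter_subset_filter _ fun n hn => ?_)
    rw [Finset.mem_Ico] at hn
    rw [Finset.mem_Icc]
    constructor
    · exact hn.1
    · have : q * d ≤ X := Nat.div_mul_le_self X d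
      omega
  have hup : ((Finset.Icc 1 X).filter fun n : ℕ => d ∣ gAbs a b c n).card ≤
      (q + 1) * rhoG a b c d := by
    rw [← card_filter_Ico_one_dvd_gAbs d (q + 1)]
    refine Finset.card_le_card (Finset.filter_subset_filter _ fun n hn => ?_)
    rw [Finset.mem_Icc] at hn
    rw [Finset.mem_Ico]
    constructor
    · exact hn.1
    · have h3 : X < (q + 1) * d := by
        have : (q + 1) * d = d * q + d := by ring
        omega
      omega
  have hd0 : (0 : ℝ) < d := by exact_mod_cast hdpos
  have h1 : (q : ℝ) * d ≤ x := by
    calc (q : ℝ) * d = ((q * d : ℕ) : ℝ) := by push_cast; ring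
      _ ≤ X := by exact_mod_cast Nat.div_mul_le_self X d
      _ ≤ x := Nat.floor_le hx
  have h2 : x ≤ ((q : ℝ) + 1) * d := by
    have h3 : X + 1 ≤ (q + 1) * d := by
      have : (q + 1) * d = d * q + d := by ring
      omega
    calc x ≤ (X : ℝ) + 1 := (Nat.lt_floor_add_one x).le
      _ = ((X + 1 : ℕ) : ℝ) := by push_cast; ring
      _ ≤ (((q + 1) * d : ℕ) : ℝ) := by exact_mod_cast h3
      _ = ((q : ℝ) + 1) * d := by push_cast; ring
  set cnt := ((Finset.Icc 1 X).filter fun n : ℕ => d ∣ gAbs a b c n).card with hcnt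
  have hlow' : (q : ℝ) * rhoG a b c d ≤ cnt := by exact_mod_cast hlow
  have hup' : (cnt : ℝ) ≤ ((q : ℝ) + 1) * rhoG a b c d := by exact_mod_cast hup
  have hρ0 : (0 : ℝ) ≤ rhoG a b c d := Nat.cast_nonneg _
  have hA : (rhoG a b c d : ℝ) * x / d ≤ ((q : ℝ) + 1) * rhoG a b c d := by
    rw [div_le_iff₀ hd0]
    calc (rhoG a b c d : ℝ) * x ≤ rhoG a b c d * (((q : ℝ) + 1) * d) :=
          mul_le_mul_of_nonneg_left h2 hρ0
      _ = _ := by ring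
  have hB : (q : ℝ) * rhoG a b c d ≤ (rhoG a b c d : ℝ) * x / d := by
    rw [le_div_iff₀ hd0]
    calc (q : ℝ) * rhoG a b c d * d = rhoG a b c d * ((q : ℝ) * d) := by ring
      _ ≤ rhoG a b c d * x := mul_le_mul_of_nonneg_left h1 hρ0
  rw [abs_le]
  constructor <;> linarith

/-- `|B(x; m, N)| ≤ ρ_G(m) ∑_{n<N} ρ_G(n)` for `|b_n| ≤ 1`, `m ≥ 1`, `x ≥ 0` (trivial estimate and
multiplicativity of `ρ_G`; Lemke Oliver p. 250). [cite: IwaniecInventiones1978, §4 p. 176] -/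
theorem abs_bilinearBG_le {x : ℝ} (hx : 0 ≤ x) {bc : ℕ → ℝ} (hb : ∀ n, |bc n| ≤ 1) {m : ℕ}
    (hm : m ≠ 0) (N : ℝ) :
    |bilinearBG a b c x bc m N| ≤
      (rhoG a b c m : ℝ) * ∑ n ∈ Finset.Ico 1 ⌈N⌉₊, (rhoG a b c n : ℝ) := by
  unfold bilinearBG
  calc |∑ n ∈ (Finset.Ico 1 ⌈N⌉₊).filter (fun n : ℕ => n.Coprime m), bc n * remG a b c x (m * n)|
      ≤ ∑ n ∈ (Finset.Ico 1 ⌈N⌉₊).filter (fun n : ℕ => n.Coprime m),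
          |bc n * remG a b c x (m * n)| := Finset.abs_sum_le_sum_abs _ _
    _ ≤ ∑ n ∈ (Finset.Ico 1 ⌈N⌉₊).filter (fun n : ℕ => n.Coprime m),
          (rhoG a b c m : ℝ) * rhoG a b c n := by
        refine Finset.sum_le_sum fun n hn => ?_
        simp only [Finset.mem_filter, Finset.mem_Ico] at hn
        have hn0 : n ≠ 0 := by omega
        rw [abs_mul]
        calc |bc n| * |remG a b c x (m * n)| ≤ 1 * (rhoG a b c (m * n) : ℝ) :=
              mul_le_mul (hb n) (abs_remG_le_rhoG hx (mul_ne_zero hm hn0)) (abs_nonneg _)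
                zero_le_one
          _ = (rhoG a b c m : ℝ) * rhoG a b c n := by
              rw [one_mul, rhoG_mul_of_coprime hn.2.symm]; push_cast; ring
    _ ≤ ∑ n ∈ Finset.Ico 1 ⌈N⌉₊, (rhoG a b c m : ℝ) * rhoG a b c n :=
        Finset.sum_le_sum_of_subset_of_nonneg (Finset.filter_subset _ _)
          fun _ _ _ => by positivity
    _ = _ := by rw [Finset.mul_sum]

/-! ### One dyadic block: Cauchy's inequality and Proposition 1 -/

/-- **Cauchy's inequality on a block `M < m < 2M`** for `B_G`: if
`∑ B² ≤ C₁(1 + N^{7/2}M^{−5/4}x)x^{1+ε}` then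
`(∑ |B|)² ≤ 3C₁(M x^{1+ε} + N^{7/2} M^{−1/4} x · x^{1+ε})` (`M ≥ 1`).
[cite: IwaniecInventiones1978, §4 p. 176] -/
theorem sq_sum_abs_bilinearBG_le {C₁ ε x N M : ℝ} {bc : ℕ → ℝ}
    (hP : ∑ m ∈ (Finset.Icc 1 ⌈2 * M⌉₊).filter (fun m : ℕ => M < m ∧ (m : ℝ) < 2 * M),
        bilinearBG a b c x bc m N ^ 2 ≤
          C₁ * (1 + N ^ (7 / 2 : ℝ) * M ^ (-(5 / 4 : ℝ)) * x) * x ^ (1 + ε))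
    (hM : 1 ≤ M) :
    (∑ m ∈ (Finset.Icc 1 ⌈2 * M⌉₊).filter (fun m : ℕ => M < m ∧ (m : ℝ) < 2 * M),
        |bilinearBG a b c x bc m N|) ^ 2 ≤
      3 * C₁ * (M * x ^ (1 + ε) + N ^ (7 / 2 : ℝ) * M ^ (-(1 / 4 : ℝ)) * x * x ^ (1 + ε)) := by
  set R := (Finset.Icc 1 ⌈2 * M⌉₊).filter (fun m : ℕ => M < m ∧ (m : ℝ) < 2 * M) with hR
  have hM0 : 0 < M := by linarith
  have hcard : (R.card : ℝ) ≤ 3 * M := by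
    calc (R.card : ℝ) ≤ ((Finset.Icc 1 ⌈2 * M⌉₊).card : ℝ) := by
          exact_mod_cast Finset.card_filter_le _ _
      _ = ⌈2 * M⌉₊ := by simp
      _ ≤ 2 * M + 1 := (Nat.ceil_lt_add_one (by linarith)).le
      _ ≤ 3 * M := by linarith
  have hcs : (∑ m ∈ R, |bilinearBG a b c x bc m N|) ^ 2 ≤
      R.card * ∑ m ∈ R, |bilinearBG a b c x bc m N| ^ 2 :=
    sq_sum_le_card_mul_sum_sq
  have hsq : ∑ m ∈ R, |bilinearBG a b c x bc m N| ^ 2 = ∑ m ∈ R, bilinearBG a b c x bc m N ^ 2 := by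
    simp [sq_abs]
  have hS0 : 0 ≤ ∑ m ∈ R, bilinearBG a b c x bc m N ^ 2 := Finset.sum_nonneg fun _ _ => sq_nonneg _
  have hpow : M * M ^ (-(5 / 4 : ℝ)) = M ^ (-(1 / 4 : ℝ)) := by
    rw [show (-(1 / 4 : ℝ)) = 1 + -(5 / 4 : ℝ) by norm_num, Real.rpow_add hM0, Real.rpow_one]
  calc (∑ m ∈ R, |bilinearBG a b c x bc m N|) ^ 2
      ≤ R.card * ∑ m ∈ R, bilinearBG a b c x bc m N ^ 2 := by rw [← hsq]; exact hcs
    _ ≤ (3 * M) * (C₁ * (1 + N ^ (7 / 2 : ℝ) * M ^ (-(5 / 4 : ℝ)) * x) * x ^ (1 + ε)) :=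
        mul_le_mul hcard hP hS0 (by linarith)
    _ = 3 * C₁ * (M * x ^ (1 + ε) +
          N ^ (7 / 2 : ℝ) * (M * M ^ (-(5 / 4 : ℝ))) * x * x ^ (1 + ε)) := by ring
    _ = _ := by rw [hpow]

/-! ### The Corollary from Proposition 1 -/

/-- `∑_{m ≤ y} ρ_G(m) ≤ C_G y` for `y ≥ 2` (the tree's mean value of `ρ_f` for the irreducible
`f = G` of degree `2`). [folklore] -/
theorem exists_sum_rhoG_le (ha : a ≠ 0) (hirr : Irreducible (quadPoly a b c)) :
    ∃ C : ℝ, 0 < C ∧ ∀ y : ℝ, 2 ≤ y → ∑ m ∈ Finset.Icc 1 ⌊y⌋₊, (rhoG a b c m : ℝ) ≤ C * y := by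
  have hdeg : 0 < (quadPoly a b c).natDegree := by rw [natDegree_quadPoly ha]; norm_num
  obtain ⟨C, hC0, hC⟩ := Literature.NumberTheory.Sieve.exists_sum_rootCount_le hirr hdeg
  exact ⟨C, hC0, fun y hy => by simpa only [rhoG] using hC y hy⟩

set_option maxHeartbeats 800000 in
/-- **The Corollary of Proposition 1 from Proposition 1, for `𝒜_G` — PROVED** (p. 176: "By
Cauchy's inequality and trivial estimate … one simply derives from Proposition 1 the Corollary";
Lemke Oliver p. 250, end of the proof of Lemma 3).  With `N = x^{1/15−ε}`, `D = x^{1−4ε}`,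
`t = max(2, x^{14/15−ε})`: for `m < t` the trivial estimate `|B| ≤ ρ_G(m) ∑_{n<N} ρ_G(n)` and
`∑_{m≤y} ρ_G(m) ≤ C_G y`; for `t ≤ m < D` the dyadic classes `⌊log₂ m⌋ = i` (`≤ 2 log x` of them) lie
in blocks `M < m < 2M`, `M = 2^i − 1/4`, where Cauchy and Proposition 1 give
`(∑ |B|)² ≤ 16 C₁ x^{2−9ε/4}`. [cite: IwaniecInventiones1978, Corollary p. 176] -/
theorem proposition1G_corollary_of_prop1G (ha : 0 < a) (hirr : Irreducible (quadPoly a b c))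
    (h1 : proposition1G a b c) : proposition1G_corollary a b c := by
  intro ε hε
  -- the degenerate case `ε ≥ 1/15`: the range `n < x^{1/15-ε} ≤ 1` is empty
  rcases le_or_gt (1 / 15) ε with hε15 | hε15
  · refine ⟨0, fun x bc hx hb hbs => ?_⟩
    have hN : ⌈x ^ (1 / 15 - ε)⌉₊ ≤ 1 := by
      refine Nat.ceil_le.mpr ?_
      rw [Nat.cast_one]
      exact Real.rpow_le_one_of_one_le_of_nonpos (by linarith) (by linarith)
    have hB : ∀ m, bilinearBG a b c x bc m (x ^ (1 / 15 - ε)) = 0 := fun m => by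
      unfold bilinearBG
      refine Finset.sum_eq_zero fun n hn => ?_
      simp only [Finset.mem_filter, Finset.mem_Ico] at hn
      omega
    have h0 : ∑ m ∈ Finset.Ico 1 ⌈x ^ (1 - 4 * ε)⌉₊,
        |bilinearBG a b c x bc m (x ^ (1 / 15 - ε))| = 0 :=
      Finset.sum_eq_zero fun m _ => by rw [hB m, abs_zero]
    rw [h0, zero_mul]
  obtain ⟨C₁, hC₁⟩ := h1 ε hε
  obtain ⟨Cρ, hCρ0, hCρ⟩ := exists_sum_rhoG_le ha.ne' hirr
  set C₁' : ℝ := max C₁ 1 with hC₁'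
  have hC₁'0 : 0 ≤ C₁' := le_trans zero_le_one (le_max_right _ _)
  have hC₁le : C₁ ≤ C₁' := le_max_left _ _
  refine ⟨9 * Cρ ^ 2 + 64 / ε * Real.sqrt C₁', fun x bc hx hb hbs => ?_⟩
  -- notation and basic sizes
  have hx0 : 0 < x := by linarith
  have hx1 : 1 ≤ x := by linarith
  set N : ℝ := x ^ (1 / 15 - ε) with hNdef
  set D : ℝ := x ^ (1 - 4 * ε) with hDdef
  set t : ℝ := max 2 (x ^ (14 / 15 - ε)) with htdef
  set K : ℕ := ⌈t⌉₊ with hKdef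
  have hN1 : 1 ≤ N := Real.one_le_rpow hx1 (by linarith)
  have hDx : D ≤ x := by
    calc D = x ^ (1 - 4 * ε) := rfl
      _ ≤ x ^ (1 : ℝ) := Real.rpow_le_rpow_of_exponent_le hx1 (by linarith)
      _ = x := Real.rpow_one x
  have ht2 : 2 ≤ t := le_max_left _ _
  have ht0 : 0 < t := by linarith
  have htK : t ≤ K := Nat.le_ceil t
  have hxe : (1 : ℝ) ≤ x ^ (1 - ε) := Real.one_le_rpow hx1 (by linarith)
  set S := Finset.Ico 1 ⌈D⌉₊ with hS
  set g : ℕ → ℝ := fun m => |bilinearBG a b c x bc m N| with hg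
  have hg0 : ∀ m, 0 ≤ g m := fun m => abs_nonneg _
  rw [← Finset.sum_filter_add_sum_filter_not S (fun m : ℕ => m < K) g]
  -- ### Part 1: `m < K`, the trivial estimate
  have hρN : ∑ n ∈ Finset.Ico 1 ⌈N⌉₊, (rhoG a b c n : ℝ) ≤ Cρ * (N + 2) := by
    calc ∑ n ∈ Finset.Ico 1 ⌈N⌉₊, (rhoG a b c n : ℝ)
        ≤ ∑ n ∈ Finset.Icc 1 ⌊max N 2⌋₊, (rhoG a b c n : ℝ) :=
          Finset.sum_le_sum_of_subset_of_nonneg (Ico_one_ceil_subset N)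
            fun _ _ _ => Nat.cast_nonneg _
      _ ≤ Cρ * max N 2 := hCρ _ (le_max_right _ _)
      _ ≤ Cρ * (N + 2) := by
          refine mul_le_mul_of_nonneg_left (max_le (by linarith) (by linarith)) hCρ0.le
  have hρt : ∑ m ∈ S.filter (fun m : ℕ => m < K), (rhoG a b c m : ℝ) ≤ Cρ * t := by
    calc ∑ m ∈ S.filter (fun m : ℕ => m < K), (rhoG a b c m : ℝ) ≤
          ∑ m ∈ Finset.Icc 1 ⌊t⌋₊, (rhoG a b c m : ℝ) := by
          refine Finset.sum_le_sum_of_subset_of_nonneg (fun m hm => ?_) fun _ _ _ =>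
            Nat.cast_nonneg _
          simp only [Finset.mem_filter, hS, Finset.mem_Ico] at hm
          rw [Finset.mem_Icc]
          refine ⟨hm.1.1, Nat.le_floor ?_⟩
          exact (Nat.lt_ceil.mp hm.2).le
      _ ≤ Cρ * t := hCρ t ht2
  have hpart1 : ∑ m ∈ S.filter (fun m : ℕ => m < K), g m ≤ 9 * Cρ ^ 2 * x ^ (1 - ε) := by
    calc ∑ m ∈ S.filter (fun m : ℕ => m < K), g m
        ≤ ∑ m ∈ S.filter (fun m : ℕ => m < K),
            (rhoG a b c m : ℝ) * ∑ n ∈ Finset.Ico 1 ⌈N⌉₊, (rhoG a b c n : ℝ) := by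
          refine Finset.sum_le_sum fun m hm => ?_
          simp only [Finset.mem_filter, hS, Finset.mem_Ico] at hm
          exact abs_bilinearBG_le hx0.le hb (by omega) N
      _ = (∑ m ∈ S.filter (fun m : ℕ => m < K), (rhoG a b c m : ℝ)) *
            ∑ n ∈ Finset.Ico 1 ⌈N⌉₊, (rhoG a b c n : ℝ) := by rw [Finset.sum_mul]
      _ ≤ (Cρ * t) * (Cρ * (N + 2)) :=
          mul_le_mul hρt hρN (Finset.sum_nonneg fun _ _ => Nat.cast_nonneg _) (by positivity)
      _ ≤ (Cρ * (x ^ (14 / 15 - ε) + 2)) * (Cρ * (N + 2)) := by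
          have : t ≤ x ^ (14 / 15 - ε) + 2 :=
            max_le (by linarith [Real.rpow_nonneg hx0.le (14 / 15 - ε)]) (by linarith)
          gcongr
      _ = Cρ ^ 2 * (x ^ (14 / 15 - ε) * N + 2 * x ^ (14 / 15 - ε) + 2 * N + 4) := by ring
      _ ≤ Cρ ^ 2 * (x ^ (1 - ε) + 2 * x ^ (1 - ε) + 2 * x ^ (1 - ε) + 4 * x ^ (1 - ε)) := by
          have e1 : x ^ (14 / 15 - ε) * N ≤ x ^ (1 - ε) := by
            rw [hNdef, ← Real.rpow_add hx0]
            exact Real.rpow_le_rpow_of_exponent_le hx1 (by linarith)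
          have e2 : x ^ (14 / 15 - ε) ≤ x ^ (1 - ε) :=
            Real.rpow_le_rpow_of_exponent_le hx1 (by linarith)
          have e3 : N ≤ x ^ (1 - ε) := Real.rpow_le_rpow_of_exponent_le hx1 (by linarith)
          have hC2 : 0 ≤ Cρ ^ 2 := sq_nonneg _
          refine mul_le_mul_of_nonneg_left ?_ hC2
          linarith
      _ = 9 * Cρ ^ 2 * x ^ (1 - ε) := by ring
  -- ### Part 2: `K ≤ m < D`, dyadic classes and Proposition 1
  set I : ℕ := ⌊Real.logb 2 x⌋₊ with hIdef
  have hI : (I : ℝ) ≤ 2 * Real.log x := floor_logb_le x hx1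
  set S₂ := S.filter (fun m : ℕ => ¬ m < K) with hS₂
  have hmemS₂ : ∀ m ∈ S₂, 1 ≤ m ∧ (m : ℝ) < D ∧ t ≤ m := by
    intro m hm
    simp only [hS₂, hS, Finset.mem_filter, Finset.mem_Ico, not_lt] at hm
    refine ⟨hm.1.1, Nat.lt_ceil.mp hm.1.2, htK.trans (by exact_mod_cast hm.2)⟩
  have hmaps : ∀ m ∈ S₂, Nat.log 2 m ∈ Finset.Icc 1 I := by
    intro m hm
    obtain ⟨hm1, hmD, htm⟩ := hmemS₂ m hm
    rw [Finset.mem_Icc]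
    constructor
    · refine Nat.log_pos (by norm_num) ?_
      have : (2 : ℝ) ≤ m := ht2.trans htm
      exact_mod_cast this
    · refine le_floor_logb_of_pow_le hx0 ?_
      have h2 : ((2 ^ Nat.log 2 m : ℕ) : ℝ) ≤ m := by
        exact_mod_cast Nat.pow_log_le_self 2 (by omega)
      push_cast at h2
      linarith
  rw [← Finset.sum_fiberwise_of_maps_to hmaps]
  -- the bound for one class
  have hclass : ∀ i ∈ Finset.Icc 1 I,
      ∑ m ∈ S₂.filter (fun m : ℕ => Nat.log 2 m = i), g m ≤
        4 * Real.sqrt C₁' * x ^ (1 - 9 * ε / 8) := by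
    intro i hi
    rw [Finset.mem_Icc] at hi
    have hbound0 : 0 ≤ 4 * Real.sqrt C₁' * x ^ (1 - 9 * ε / 8) := by positivity
    rcases (S₂.filter (fun m : ℕ => Nat.log 2 m = i)).eq_empty_or_nonempty with h0 | ⟨m₀, hm₀⟩
    · rw [h0, Finset.sum_empty]; exact hbound0
    rw [Finset.mem_filter] at hm₀
    obtain ⟨hm₀1, hm₀D, htm₀⟩ := hmemS₂ m₀ hm₀.1
    set M : ℝ := (2 : ℝ) ^ i - 1 / 4 with hMdef
    have h2i : (2 : ℝ) ≤ (2 : ℝ) ^ i := by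
      calc (2 : ℝ) = 2 ^ 1 := by norm_num
        _ ≤ 2 ^ i := pow_le_pow_right₀ (by norm_num) hi.1
    have hM1 : 1 ≤ M := by rw [hMdef]; linarith
    -- every `m` of the class satisfies `M < m < 2M`
    have hmem : ∀ m ∈ S₂.filter (fun m : ℕ => Nat.log 2 m = i), M < m ∧ (m : ℝ) < 2 * M := by
      intro m hm
      rw [Finset.mem_filter] at hm
      obtain ⟨hm1, -, -⟩ := hmemS₂ m hm.1
      have hlo : ((2 ^ Nat.log 2 m : ℕ) : ℝ) ≤ m := by
        exact_mod_cast Nat.pow_log_le_self 2 (by omega)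
      have hhi : ((m + 1 : ℕ) : ℝ) ≤ ((2 ^ (Nat.log 2 m + 1) : ℕ) : ℝ) := by
        exact_mod_cast Nat.lt_pow_succ_log_self (by norm_num) m
      rw [hm.2] at hlo hhi
      push_cast at hlo hhi
      constructor
      · rw [hMdef]; linarith
      · rw [hMdef]; linarith [pow_succ (2 : ℝ) i]
    have hMm₀ : M < m₀ := (hmem m₀ (Finset.mem_filter.mpr hm₀)).1
    have hm₀M : (m₀ : ℝ) < 2 * M := (hmem m₀ (Finset.mem_filter.mpr hm₀)).2
    have hMx : M < x := by linarith
    have hMD : M ≤ D := by linarith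
    have hMt : x ^ (14 / 15 - ε) / 4 ≤ M := by
      have : x ^ (14 / 15 - ε) ≤ t := le_max_right _ _
      linarith
    -- Proposition 1 on the block
    have hP := hC₁ x M N bc hM1 hMx hN1 hb hbs
    have hP' : ∑ m ∈ (Finset.Icc 1 ⌈2 * M⌉₊).filter (fun m : ℕ => M < m ∧ (m : ℝ) < 2 * M),
        bilinearBG a b c x bc m N ^ 2 ≤
          C₁' * (1 + N ^ (7 / 2 : ℝ) * M ^ (-(5 / 4 : ℝ)) * x) * x ^ (1 + ε) := by
      refine hP.trans (mul_le_mul_of_nonneg_right (mul_le_mul_of_nonneg_right hC₁le ?_) ?_)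
      · have : 0 ≤ N ^ (7 / 2 : ℝ) * M ^ (-(5 / 4 : ℝ)) * x := by positivity
        linarith
      · positivity
    have hblock := sq_sum_abs_bilinearBG_le hP' hM1
    have hsize := block_size_le (M := M) hC₁'0 hε hx hMt hMD
    -- the class is contained in the block
    have hsub : S₂.filter (fun m : ℕ => Nat.log 2 m = i) ⊆
        (Finset.Icc 1 ⌈2 * M⌉₊).filter (fun m : ℕ => M < m ∧ (m : ℝ) < 2 * M) := by
      intro m hm
      have hb2 := hmem m hm
      rw [Finset.mem_filter] at hm
      obtain ⟨hm1, -, -⟩ := hmemS₂ m hm.1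
      rw [Finset.mem_filter, Finset.mem_Icc]
      refine ⟨⟨hm1, ?_⟩, hb2⟩
      have : (m : ℝ) ≤ ⌈2 * M⌉₊ := hb2.2.le.trans (Nat.le_ceil _)
      exact_mod_cast this
    have hle : ∑ m ∈ S₂.filter (fun m : ℕ => Nat.log 2 m = i), g m ≤
        ∑ m ∈ (Finset.Icc 1 ⌈2 * M⌉₊).filter (fun m : ℕ => M < m ∧ (m : ℝ) < 2 * M), g m :=
      Finset.sum_le_sum_of_subset_of_nonneg hsub fun _ _ _ => hg0 _
    refine hle.trans ?_
    -- take square roots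
    have hsq : (∑ m ∈ (Finset.Icc 1 ⌈2 * M⌉₊).filter (fun m : ℕ => M < m ∧ (m : ℝ) < 2 * M),
        g m) ^ 2 ≤ (4 * Real.sqrt C₁' * x ^ (1 - 9 * ε / 8)) ^ 2 := by
      calc _ ≤ 16 * C₁' * x ^ (2 - 9 * ε / 4) := hblock.trans hsize
        _ = (4 * Real.sqrt C₁' * x ^ (1 - 9 * ε / 8)) ^ 2 := by
            have e : (x ^ (1 - 9 * ε / 8)) ^ 2 = x ^ (2 - 9 * ε / 4) := by
              rw [← Real.rpow_natCast, ← Real.rpow_mul hx0.le]; congr 1; push_cast; ring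
            rw [mul_pow, mul_pow, Real.sq_sqrt hC₁'0, e]; ring
    exact (pow_le_pow_iff_left₀ (Finset.sum_nonneg fun _ _ => hg0 _) hbound0
      (by norm_num : (2 : ℕ) ≠ 0)).mp hsq
  have hpart2 : ∑ i ∈ Finset.Icc 1 I, ∑ m ∈ S₂.filter (fun m : ℕ => Nat.log 2 m = i), g m ≤
      64 / ε * Real.sqrt C₁' * x ^ (1 - ε) := by
    have hlog : Real.log x ≤ x ^ (ε / 8) / (ε / 8) :=
      Real.log_le_rpow_div hx0.le (by positivity)
    calc ∑ i ∈ Finset.Icc 1 I, ∑ m ∈ S₂.filter (fun m : ℕ => Nat.log 2 m = i), g m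
        ≤ ∑ i ∈ Finset.Icc 1 I, 4 * Real.sqrt C₁' * x ^ (1 - 9 * ε / 8) :=
          Finset.sum_le_sum hclass
      _ = I * (4 * Real.sqrt C₁' * x ^ (1 - 9 * ε / 8)) := by simp
      _ ≤ (2 * Real.log x) * (4 * Real.sqrt C₁' * x ^ (1 - 9 * ε / 8)) :=
          mul_le_mul_of_nonneg_right hI (by positivity)
      _ ≤ (2 * (x ^ (ε / 8) / (ε / 8))) * (4 * Real.sqrt C₁' * x ^ (1 - 9 * ε / 8)) := by
          gcongr
      _ = 64 / ε * Real.sqrt C₁' * (x ^ (ε / 8) * x ^ (1 - 9 * ε / 8)) := by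
          field_simp; ring
      _ = 64 / ε * Real.sqrt C₁' * x ^ (1 - ε) := by
          rw [← Real.rpow_add hx0]; congr 2; ring
  calc ∑ m ∈ S.filter (fun m : ℕ => m < K), g m +
        ∑ i ∈ Finset.Icc 1 I, ∑ m ∈ S₂.filter (fun m : ℕ => Nat.log 2 m = i), g m
      ≤ 9 * Cρ ^ 2 * x ^ (1 - ε) + 64 / ε * Real.sqrt C₁' * x ^ (1 - ε) :=
        add_le_add hpart1 hpart2
    _ = (9 * Cρ ^ 2 + 64 / ε * Real.sqrt C₁') * x ^ (1 - ε) := by ring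

/-! ### The Theorem from Proposition 1 for `𝒜_G` -/

/-- **`theorem_quadratic` from Proposition 1 for every `𝒜_G`.**  If the dispersion estimate
`proposition1G a b c` holds for every `G = aX² + bX + c` with `a > 0`, `c` odd, `G` irreducible,
then Iwaniec's Theorem for general quadratics follows (Corollary above, then
`theorem_quadratic_of_prop1G`: Proposition 2 for `𝒜_G` from Lemma 2 — the tree's
`lemma2_bilinearSieve_holds` — and §6 with the numerics). [cite: IwaniecInventiones1978, Theorem p. 172] -/
theorem theorem_quadratic_of_proposition1G
    (h1 : ∀ a b c : ℤ, 0 < a → Odd c → Irreducible (quadPoly a b c) → proposition1G a b c) :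
    theorem_quadratic :=
  theorem_quadratic_of_prop1G fun a b c ha hc hirr =>
    proposition1G_corollary_of_prop1G ha hirr (h1 a b c ha hc hirr)

/-- The qualitative clause alone: `Ω(|G(n)|) ≤ 2` infinitely often, from Proposition 1 for `𝒜_G`.
[cite: LemkeOliverActaArith2012, Theorem 1] -/
theorem infinite_setOf_isAtMostAlmostPrime_of_proposition1G (ha : 0 < a) (hc : Odd c)
    (hirr : Irreducible (quadPoly a b c)) (h1 : proposition1G a b c) :
    {n : ℕ | Nat.IsAtMostAlmostPrime 2 (a * (n : ℤ) ^ 2 + b * n + c).natAbs}.Infinite :=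
  infinite_setOf_isAtMostAlmostPrime_of_prop1G ha hc hirr
    (proposition1G_corollary_of_prop1G ha hirr h1)

end Literature.NumberTheory.Sieve.Iwaniec1978

end
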